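import Summits.QuantumFields.YangMills.Theorems.UnitScaleTiltHalvingP1FlatCoreSupplierPreGauge
import Summits.QuantumFields.YangMills.Theorems.UnitScaleTiltHalvingP1FlatCoreSupplierInduction
import Literature.MathematicalPhysics.QuantumFieldTheory.Balaban1983to89.B8Eq131CubesAdmissible
import HarnessLib

/-!
# `hP1room` PROGRAMME (LEAD-H BOARD v3, (K-site) «k = 1 branch → ★w7», 2026-08-28T18:11Z), THE BASE MEMBER's DATUM HALF: ★★ J3's PRE-GAUGE CHART WITH THE
# `SU(2)` GAUGE EXPLICIT, and ★★ the BODY-SHAPED chart rows at N05's cube member for the TRIVIAL datum (`u₁ := 1`, `W := U′ := (U^{gJ})♯`, `A` = the cutoff one-form)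

Route `UnitScaleTilt`, crux K1 child «MinimiserStabilityRegPr» (stmt-QuantumFields-19200), registered stub `stub_halvingStep` (`BirthV10`), text `H = hSupUρ3 ⟸ hMember`
(✓`HalvingHSupURho3OfSiteRows` ∘ per site ✓p647313 `hSupBlock_of_topRows`; the `K − n = 1` branch of the per-site composer reads ✓p650673∕✓p652996
`topRows_of_preGauge_base(_traceFree)` at the trivial datum).  Cell `ym3-torus` (HUMAN RULING D-0037: YM₃ on T³ is ladder rung R3 — NOT d = 4, NOT a mass gap,
NOT the Clay problem), width seat `ym-ust-19200-w7` gen 5.  `--supports stmt-QuantumFields-19200 --as helper`; THEOREMS ONLY (0 `def`, 0 `sorry`); count-neutral;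
nothing here claims `hSupU`, `hMember`, the stub, the crux or the gap.

WHAT.  `k := K − n`, `η := L^{−k}`, `U′ := pull (unitsField (toUField (U^{gJ}))) 0` (J3's native `ℤ³` letter), top box `□̃^{(k)} = [tLo a ρ′, tHi a M′ ρ′]`,
`s := 22d²ε₀ + 4·l1(tHi − tLo)·ε₀`.
* §1 ★★ `exists_preGauge_chart_su` — ✓`HalvingP1FlatCoreSupplierPreGauge.exists_preGauge_chart` (✓p645784 §2) with the `SU(2)` torus gauge `gJ : Site → SU(2)` KEPT
  EXPLICIT (the body's `hW` letter names `GaugeField.gaugeAct gJ U`; ✓p645784's `∃ g` hid it): J3's rows (a) `U′ ∈ 𝔄_k(ε₀)`, (b′) `U′ ∈ Ax_m(ℭ, 1)`, (d) (1.66) on the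
  whole tower below □̃ VERBATIM (✓`exists_preGauge_flat`), the bridge `unitsField (toUField (U^{gJ})) = (U♭)^{toUnits ∘ suIncl ∘ gJ}`, and the cutoff one-form `A` of
  `unitsField (toUField (U^{gJ}))` (✓`exists_cutoff_oneForm`): Hermitian, traceless, `η‖A‖ ≤ 1∕2` EVERYWHERE, and on every fine bond of □̃: `U′ x ν = e^{iηA(x,ν)}`,
  `η‖A(x,ν)‖ ≤ 2s`, `‖U′ x ν − 1‖ < s`.
* §2 ★★ `baseDatum_of_preGauge_cubeMember` — the same at N05's cube member `Ω_j := cubeFam false L a M′ ρ′ k j` in the letters of the per-site BODY (LEAD-H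
  `hMember`, 2026-08-28T18:15Z) for the TRIVIAL datum: `hchart₀` on `{b ∣ SideTouches (Ω 0) b}` (every such side lies in □̃: lit ✓`collar_cube` +
  ✓`HalvingP1FlatCoreSupplierInduction.ends_of_sideTouches`), `hchartTop` on `□_k = cube L a M′ ρ′ k k` with `c₁ := 2s` (then `hc₁`∕`c′ := 2L·(2s)` by
  ✓`HalvingP1FlatCoreSupplierAssembly.hc₁_of_small … 0` at `k = 1`), the base-datum rows `hArows` of ✓p650673 on `Ω 0` (both bonds `(x, μ)`, `(x − e_μ, μ)`), the GLOBAL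
  rows `hAsa`∕`(A x μ).trace = 0`∕`η‖A‖ ≤ 1∕2`, the fine near-`1` `< s` on □̃ (for (K-DE)'s reads, `□_k ⊆ □̃`) and `U′ ∈ 𝔄_k(ε₀)`, `U′ ∈ Ax_m(ℭ, 1)`.
HONEST SCOPE.  Bookkeeping on ✓p645784∕J3 and the cube geometry; no analytic content; the `K − n = 1` composer `siteRows_of_sockets_base` is the next file.

References: T. Bałaban, CMP **99** (1985) 75–102 [Balaban1985RegularSpaces] ((1.33)–(1.36) p.82, (1.65)–(1.66) p.87, Thm 4 p.88, p.98 (the collar of □₀ in □̃));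
CMP **98** (1985) 17–51 [Balaban1985Averaging] ((8) p.18, (21)–(23) p.21); CMP **102** (1985) 277–309 [Balaban1985Variational] ((2) p.278, (152) p.301).
-/

set_option autoImplicit false

noncomputable section

open scoped Matrix.Norms.L2Operator

namespace Summit.QuantumFields.YangMills.Theorems.HalvingP1FlatCoreSupplierPreGaugeMember

open NormedSpace
open Complex (I)
open Literature.MathematicalPhysics.QuantumFieldTheory.Balaban1983to89
open Literature.MathematicalPhysics.QuantumFieldTheory.Balaban1983to89.T3ContinuumYM3Torus
open Literature.MathematicalPhysics.QuantumFieldTheory.Balaban1983to89.T3PrintedRegularMinimiser (RegPr)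
open B7Prop1Explicit renaming Site → LSite
open B7Prop1Explicit (e l1)
open B7Prop1Local (InBox)
open B7Prop2Explicit (avgIter avgIter_zero)
open B7Prop2SpecialUnitary (specialUnitaryUnits)
open B8Ineq130 (tlo thi)
open B8Ineq132 (InAk Collar)
open B8Eq119TwistedAxial (InAx)
open B8Eq131Cubes (cube tLo tHi collar_cube cube_anti)
open B8Eq131CubesAdmissible (cubeFam cubeFam_false_of_le)
open B8Eq140Level (SideTouches)
open B8Eq184Proof (cfgExp)
open B8Eq138LandauZd (logCfg)
open B10Eq27TorusAxialLog (transl pull pull_apply unitsField toUField suIncl gaugeActT val_unitsField val_suIncl)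
open Summit.QuantumFields.YangMills.Theorems.P1FlatCorePreGauge (exists_preGauge_flat preGauge_windows)
open Summit.QuantumFields.YangMills.Theorems.HalvingP1FlatCoreSupplierPreGauge (exists_cutoff_oneForm)
open Summit.QuantumFields.YangMills.Theorems.HalvingP1FlatCoreSupplierInduction (ends_of_sideTouches)

variable (F : T3Family) {n K : ℕ}

/-! ## §1 J3's chart with the `SU(2)` gauge explicit -/

/-- ★★ **THE PRE-GAUGE CHART WITH THE `SU(2)` GAUGE EXPLICIT** — ✓`HalvingP1FlatCoreSupplierPreGauge.exists_preGauge_chart` with `gJ : Site → SU(2)` kept (J3's rows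
(a)(b′)(d) VERBATIM in `U′ := pull (unitsField (toUField (U^{gJ}))) 0` letters, the units bridge, and the cutoff one-form's global ∕ territory rows).
[cite: Balaban1985RegularSpaces, (1.33)-(1.36) p.82, (1.65)-(1.66) p.87, Thm 4 p.88; Balaban1985Variational, (2) p.278, (152) p.301; Balaban1985Averaging, (8) p.18, (21)-(23) p.21] -/
theorem exists_preGauge_chart_su (hnK : n < K) {ε₀ : ℝ} (hε₀ : 0 < ε₀) (hε : 10 ^ 7 * (F.L : ℝ) ^ 3 * ε₀ ≤ 1)
    {U : GaugeField (F.P K) 0 (Matrix.specialUnitaryGroup (Fin 2) ℂ)} (hU : RegPr F n K ε₀ U)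
    (a : LSite (F.P K).d) (M' ρ' : ℕ)
    (hwrap : ∀ i, tHi a M' ρ' i - tLo a ρ' i < ((F.P K).sitesPerDir (K - n) : ℤ))
    (hsmall : 11 * ((F.P K).d : ℝ) ^ 2 * (2 * ε₀) + l1 (tHi a M' ρ' - tLo a ρ') * (2 * (2 * ε₀)) ≤ 1 / 6) :
    ∃ (gJ : GaugeTransf (F.P K) 0 (Matrix.specialUnitaryGroup (Fin 2) ℂ)) (A : LSite (F.P K).d → Fin (F.P K).d → Matrix (Fin 2) (Fin 2) ℂ),
      -- the units bridge
      unitsField (toUField (GaugeField.gaugeAct gJ U)) = gaugeActT (fun x => Unitary.toUnits (suIncl (gJ x))) (unitsField (toUField U)) ∧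
      -- J3 (a): `U′ ∈ 𝔄_k(ε₀)`
      InAk (F.P K).L (K - n) (((F.L : ℝ)⁻¹) ^ (K - n)) ε₀ (fun _ => (Set.univ : Set (LSite (F.P K).d)))
        (pull (unitsField (toUField (GaugeField.gaugeAct gJ U))) 0) ∧
      -- J3 (b′): `U′ ∈ Ax_m(ℭ, 1)`
      (∀ m, m ≤ K - n → ∀ Λ : ℕ → Set (LSite (F.P K).d),
        InAx (F.P K).L m Λ (1 : LSite (F.P K).d → Fin (F.P K).d → (Matrix (Fin 2) (Fin 2) ℂ)ˣ) (pull (unitsField (toUField (GaugeField.gaugeAct gJ U))) 0)) ∧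
      -- J3 (d): (1.66) at background `1` on the whole tower below □̃^{(k)}
      (∀ m, m ≤ K - n → ∀ (x : LSite (F.P K).d) (ν : Fin (F.P K).d), tlo (F.P K).L (tLo a ρ') m ≤ x → x + e ν ≤ thi (F.P K).L (tHi a M' ρ') m →
        ‖((avgIter (F.P K).L (pull (unitsField (toUField (GaugeField.gaugeAct gJ U))) 0) (K - n - m) x ν : (Matrix (Fin 2) (Fin 2) ℂ)ˣ) :
            Matrix (Fin 2) (Fin 2) ℂ) - 1‖ < 11 * ((F.P K).d : ℝ) ^ 2 * (2 * ε₀) + l1 (tHi a M' ρ' - tLo a ρ') * (2 * (2 * ε₀))) ∧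
      -- the cutoff one-form: GLOBAL rows
      (∀ (x : LSite (F.P K).d) (ν : Fin (F.P K).d), IsSelfAdjoint (A x ν)) ∧
      (∀ (x : LSite (F.P K).d) (ν : Fin (F.P K).d), (A x ν).trace = 0) ∧
      (∀ (x : LSite (F.P K).d) (ν : Fin (F.P K).d), ((F.L : ℝ)⁻¹) ^ (K - n) * ‖A x ν‖ ≤ 1 / 2) ∧
      -- on the fine territory of □̃: the chart, the (1.36) size, the near-`1`
      (∀ (x : LSite (F.P K).d) (ν : Fin (F.P K).d), tlo (F.P K).L (tLo a ρ') (K - n) ≤ x → x + e ν ≤ thi (F.P K).L (tHi a M' ρ') (K - n) →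
        pull (unitsField (toUField (GaugeField.gaugeAct gJ U))) 0 x ν = cfgExp (((F.L : ℝ)⁻¹) ^ (K - n)) A x ν ∧
        ((F.L : ℝ)⁻¹) ^ (K - n) * ‖A x ν‖ ≤ 2 * (11 * ((F.P K).d : ℝ) ^ 2 * (2 * ε₀) + l1 (tHi a M' ρ' - tLo a ρ') * (2 * (2 * ε₀))) ∧
        ‖((pull (unitsField (toUField (GaugeField.gaugeAct gJ U))) 0 x ν : (Matrix (Fin 2) (Fin 2) ℂ)ˣ) : Matrix (Fin 2) (Fin 2) ℂ) - 1‖ <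
          11 * ((F.P K).d : ℝ) ^ 2 * (2 * ε₀) + l1 (tHi a M' ρ' - tLo a ρ') * (2 * (2 * ε₀))) := by
  have hL0 : (F.L : ℝ) ≠ 0 := Nat.cast_ne_zero.2 (F.P K).L_pos.ne'
  set η : ℝ := ((F.L : ℝ)⁻¹) ^ (K - n) with hηdef
  have hη : 0 < η := pow_pos (inv_pos.2 (Nat.cast_pos.2 (F.P K).L_pos)) _
  set s₀ : ℝ := 11 * ((F.P K).d : ℝ) ^ 2 * (2 * ε₀) + l1 (tHi a M' ρ' - tLo a ρ') * (2 * (2 * ε₀)) with hs₀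
  have hs₀4 : s₀ ≤ 1 / 4 := hsmall.trans (by norm_num)
  obtain ⟨hε3, hε2, -⟩ := preGauge_windows F (K := K) hε₀.le hε (B := 0) (by norm_num)
  obtain ⟨gJ, hInAk, -, -, hInAx, -, -, htower⟩ :=
    exists_preGauge_flat F hnK hε₀ hε3 hε2 hU (tLo a ρ') (tHi a M' ρ') hwrap hsmall 1 (Subgroup.one_mem _)
  have hbridge : unitsField (toUField (GaugeField.gaugeAct gJ U)) = gaugeActT (fun x => Unitary.toUnits (suIncl (gJ x))) (unitsField (toUField U)) := by
    rw [T3PrintedRegularOrbits.toUField_gaugeAct, B10Eq68TorusRegularity.unitsField_gaugeAct]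
  set W₁ : GaugeField (F.P K) 0 (Matrix (Fin 2) (Fin 2) ℂ)ˣ := unitsField (toUField (GaugeField.gaugeAct gJ U)) with hW₁
  have hWsu : ∀ b : PBond (F.P K) 0, ((W₁ b : (Matrix (Fin 2) (Fin 2) ℂ)ˣ) : Matrix (Fin 2) (Fin 2) ℂ) ∈ Matrix.specialUnitaryGroup (Fin 2) ℂ := by
    intro b
    rw [hW₁, val_unitsField]
    show ((suIncl (GaugeField.gaugeAct gJ U b) : Matrix.unitaryGroup (Fin 2) ℂ) : Matrix (Fin 2) (Fin 2) ℂ) ∈ _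
    rw [val_suIncl]
    exact (GaugeField.gaugeAct gJ U b).2
  -- the fine territory: (d) at `m = k`
  have hfine : ∀ (x : LSite (F.P K).d) (ν : Fin (F.P K).d), tlo (F.P K).L (tLo a ρ') (K - n) ≤ x → x + e ν ≤ thi (F.P K).L (tHi a M' ρ') (K - n) →
      ‖((W₁ ⟨transl 0 x, ν⟩ : (Matrix (Fin 2) (Fin 2) ℂ)ˣ) : Matrix (Fin 2) (Fin 2) ℂ) - 1‖ < s₀ := by
    intro x ν hx hxν
    have h := htower (K - n) le_rfl x ν hx hxν
    rwa [Nat.sub_self, avgIter_zero, pull_apply] at h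
  obtain ⟨A, hAsa, hAtr, hAhalf, hAnear⟩ := exists_cutoff_oneForm hη W₁ hWsu
  refine ⟨gJ, A, hbridge, hInAk, hInAx, htower, hAsa, hAtr, hAhalf, fun x ν hx hxν => ?_⟩
  have hb := hfine x ν hx hxν
  obtain ⟨hAx, hexp⟩ := hAnear x ν (hb.le.trans hs₀4)
  refine ⟨?_, ?_, ?_⟩
  · rw [pull_apply, hexp]
  · rw [hAx]
    exact HalvingP1FlatCoreSupplierPreGauge.eta_mul_norm_logCfg_pull_le hη W₁ x ν (hs₀4.trans (by norm_num)) hb.le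
  · rw [pull_apply]; exact hb

/-! ## §2 The body-shaped rows at N05's cube member for the trivial datum -/

/-- ★★ **THE BASE MEMBER's DATUM HALF IN THE BODY's LETTERS.**  At the cube member `Ω_j := cubeFam false L a M′ ρ′ k j` (`k := K − n`, `1 ≤ ρ′`), top box
`□̃^{(k)} = [tLo a ρ′, tHi a M′ ρ′]`: the `SU(2)` gauge `gJ`, the units bridge, `U′ ∈ 𝔄_k(ε₀)`, `U′ ∈ Ax_m(ℭ,1)`, the fine near-`1` on □̃, and the cutoff one-form `A` with
`hchart₀` (sides touching `Ω 0`), `hchartTop` (`□_k`, `c₁ := 2s`), `hArows` (both bonds at every `x ∈ Ω 0`), `hAsa`, tracelessness, `η‖A‖ ≤ 1∕2`.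
[cite: Balaban1985RegularSpaces, (1.36) p.82, (1.66) p.87, Thm 4 p.88, p.98; Balaban1985Variational, (2) p.278; Balaban1985Averaging, (8) p.18, (21)-(23) p.21] -/
theorem baseDatum_of_preGauge_cubeMember (hnK : n < K) {ε₀ : ℝ} (hε₀ : 0 < ε₀) (hε : 10 ^ 7 * (F.L : ℝ) ^ 3 * ε₀ ≤ 1)
    {U : GaugeField (F.P K) 0 (Matrix.specialUnitaryGroup (Fin 2) ℂ)} (hU : RegPr F n K ε₀ U)
    (a : LSite (F.P K).d) (M' ρ' : ℕ) (hρ' : 1 ≤ ρ')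
    (hwrap : ∀ i, tHi a M' ρ' i - tLo a ρ' i < ((F.P K).sitesPerDir (K - n) : ℤ))
    (hsmall : 11 * ((F.P K).d : ℝ) ^ 2 * (2 * ε₀) + l1 (tHi a M' ρ' - tLo a ρ') * (2 * (2 * ε₀)) ≤ 1 / 6) :
    ∃ (gJ : GaugeTransf (F.P K) 0 (Matrix.specialUnitaryGroup (Fin 2) ℂ)) (A : LSite (F.P K).d → Fin (F.P K).d → Matrix (Fin 2) (Fin 2) ℂ),
      -- the units bridge
      unitsField (toUField (GaugeField.gaugeAct gJ U)) = gaugeActT (fun x => Unitary.toUnits (suIncl (gJ x))) (unitsField (toUField U)) ∧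
      -- `U′ ∈ 𝔄_k(ε₀)` and `U′ ∈ Ax_m(ℭ, 1)`
      InAk (F.P K).L (K - n) (((F.L : ℝ)⁻¹) ^ (K - n)) ε₀ (fun _ => (Set.univ : Set (LSite (F.P K).d)))
        (pull (unitsField (toUField (GaugeField.gaugeAct gJ U))) 0) ∧
      (∀ m, m ≤ K - n → ∀ Λ : ℕ → Set (LSite (F.P K).d),
        InAx (F.P K).L m Λ (1 : LSite (F.P K).d → Fin (F.P K).d → (Matrix (Fin 2) (Fin 2) ℂ)ˣ) (pull (unitsField (toUField (GaugeField.gaugeAct gJ U))) 0)) ∧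
      -- the fine near-`1` on □̃ (for (K-DE)'s reads)
      (∀ (x : LSite (F.P K).d) (ν : Fin (F.P K).d), tlo (F.P K).L (tLo a ρ') (K - n) ≤ x → x + e ν ≤ thi (F.P K).L (tHi a M' ρ') (K - n) →
        ‖((pull (unitsField (toUField (GaugeField.gaugeAct gJ U))) 0 x ν : (Matrix (Fin 2) (Fin 2) ℂ)ˣ) : Matrix (Fin 2) (Fin 2) ℂ) - 1‖ <
          11 * ((F.P K).d : ℝ) ^ 2 * (2 * ε₀) + l1 (tHi a M' ρ' - tLo a ρ') * (2 * (2 * ε₀))) ∧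
      -- the cutoff one-form: GLOBAL rows
      (∀ (x : LSite (F.P K).d) (ν : Fin (F.P K).d), IsSelfAdjoint (A x ν)) ∧
      (∀ (x : LSite (F.P K).d) (ν : Fin (F.P K).d), (A x ν).trace = 0) ∧
      (∀ (x : LSite (F.P K).d) (ν : Fin (F.P K).d), ((F.L : ℝ)⁻¹) ^ (K - n) * ‖A x ν‖ ≤ 1 / 2) ∧
      -- `hchart₀`: the chart on the sides touching `Ω 0`
      (∀ b ∈ {b : LSite (F.P K).d × Fin (F.P K).d | SideTouches (cubeFam false (F.P K).L a M' ρ' (K - n) 0) b.1 b.2},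
        pull (unitsField (toUField (GaugeField.gaugeAct gJ U))) 0 b.1 b.2 = cfgExp (((F.L : ℝ)⁻¹) ^ (K - n)) A b.1 b.2) ∧
      -- `hchartTop`: the chart and the (1.36) size on `□_k`
      (∀ z ∈ cube (F.P K).L a M' ρ' (K - n) (K - n), ∀ ν : Fin (F.P K).d,
        pull (unitsField (toUField (GaugeField.gaugeAct gJ U))) 0 z ν = cfgExp (((F.L : ℝ)⁻¹) ^ (K - n)) A z ν ∧
        ((F.L : ℝ)⁻¹) ^ (K - n) * ‖A z ν‖ ≤ 2 * (11 * ((F.P K).d : ℝ) ^ 2 * (2 * ε₀) + l1 (tHi a M' ρ' - tLo a ρ') * (2 * (2 * ε₀)))) ∧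
      -- `hArows`: the base datum on both bonds at every `x ∈ Ω 0`
      (∀ x ∈ cubeFam false (F.P K).L a M' ρ' (K - n) 0, ∀ μ : Fin (F.P K).d,
        (pull (unitsField (toUField (GaugeField.gaugeAct gJ U))) 0 x μ = cfgExp (((F.L : ℝ)⁻¹) ^ (K - n)) A x μ ∧
          ((F.L : ℝ)⁻¹) ^ (K - n) * ‖A x μ‖ ≤ 2 * (11 * ((F.P K).d : ℝ) ^ 2 * (2 * ε₀) + l1 (tHi a M' ρ' - tLo a ρ') * (2 * (2 * ε₀)))) ∧
        (pull (unitsField (toUField (GaugeField.gaugeAct gJ U))) 0 (x - e μ) μ = cfgExp (((F.L : ℝ)⁻¹) ^ (K - n)) A (x - e μ) μ ∧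
          ((F.L : ℝ)⁻¹) ^ (K - n) * ‖A (x - e μ) μ‖ ≤ 2 * (11 * ((F.P K).d : ℝ) ^ 2 * (2 * ε₀) + l1 (tHi a M' ρ' - tLo a ρ') * (2 * (2 * ε₀))))) := by
  have hL2 : 2 ≤ (F.P K).L := (F.P K).hL.2
  obtain ⟨gJ, A, hbridge, hInAk, hInAx, htower, hAsa, hAtr, hAhalf, hterr⟩ := exists_preGauge_chart_su F hnK hε₀ hε hU a M' ρ' hwrap hsmall
  have hfine : ∀ (x : LSite (F.P K).d) (ν : Fin (F.P K).d), tlo (F.P K).L (tLo a ρ') (K - n) ≤ x → x + e ν ≤ thi (F.P K).L (tHi a M' ρ') (K - n) →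
      ‖((pull (unitsField (toUField (GaugeField.gaugeAct gJ U))) 0 x ν : (Matrix (Fin 2) (Fin 2) ℂ)ˣ) : Matrix (Fin 2) (Fin 2) ℂ) - 1‖ <
        11 * ((F.P K).d : ℝ) ^ 2 * (2 * ε₀) + l1 (tHi a M' ρ' - tLo a ρ') * (2 * (2 * ε₀)) := fun x ν hx hxν => (hterr x ν hx hxν).2.2
  -- □₀ and its collar lie in the fine territory of □̃
  have hcol : Collar (cube (F.P K).L a M' ρ' (K - n) 0) (tlo (F.P K).L (tLo a ρ') (K - n)) (thi (F.P K).L (tHi a M' ρ') (K - n)) :=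
    collar_cube hL2 hρ' (Nat.zero_le _)
  have hcube : ∀ z ∈ cube (F.P K).L a M' ρ' (K - n) 0, ∀ ν : Fin (F.P K).d,
      (tlo (F.P K).L (tLo a ρ') (K - n) ≤ z ∧ z + e ν ≤ thi (F.P K).L (tHi a M' ρ') (K - n)) ∧
        (tlo (F.P K).L (tLo a ρ') (K - n) ≤ z - e ν ∧ z - e ν + e ν ≤ thi (F.P K).L (tHi a M' ρ') (K - n)) := by
    intro z hz ν
    have he : ∀ i, (0 : ℤ) ≤ e ν i ∧ e ν i ≤ 1 := fun i => by
      rw [B7Prop1Explicit.e_apply]; split_ifs <;> norm_num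
    have h0 : InBox (tlo (F.P K).L (tLo a ρ') (K - n)) (thi (F.P K).L (tHi a M' ρ') (K - n)) z := hcol z hz z fun i => ⟨by linarith, by linarith⟩
    have h1 := hcol z hz (z + e ν) fun i => ⟨by have := (he i).1; simp only [Pi.add_apply]; linarith, by have := (he i).2; simp only [Pi.add_apply]; linarith⟩
    have h2 := hcol z hz (z - e ν) fun i => ⟨by have := (he i).2; simp only [Pi.sub_apply]; linarith, by have := (he i).1; simp only [Pi.sub_apply]; linarith⟩
    refine ⟨⟨fun i => (h0 i).1, fun i => (h1 i).2⟩, fun i => (h2 i).1, ?_⟩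
    rw [sub_add_cancel]
    exact fun i => (h0 i).2
  refine ⟨gJ, A, hbridge, hInAk, hInAx, hfine, hAsa, hAtr, hAhalf, ?_, ?_, ?_⟩
  · -- hchart₀: every side touching □₀ lies in □̃
    rintro ⟨y, τ⟩ hb
    have hb' : SideTouches (cube (F.P K).L a M' ρ' (K - n) 0) y τ := by
      rw [← cubeFam_false_of_le (F.P K).L a M' ρ' (Nat.zero_le (K - n))]; exact hb
    obtain ⟨h1, h2⟩ := ends_of_sideTouches hcol hb'
    exact (hterr y τ h1 h2).1
  · -- hchartTop: `□_k ⊆ □₀`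
    intro z hz ν
    have hz0 : z ∈ cube (F.P K).L a M' ρ' (K - n) 0 := cube_anti (Nat.zero_le _) le_rfl hz
    obtain ⟨⟨h1, h2⟩, -⟩ := hcube z hz0 ν
    exact ⟨(hterr z ν h1 h2).1, (hterr z ν h1 h2).2.1⟩
  · -- hArows
    intro x hx μ
    rw [cubeFam_false_of_le (F.P K).L a M' ρ' (Nat.zero_le (K - n))] at hx
    obtain ⟨⟨h1, h2⟩, h3, h4⟩ := hcube x hx μ
    exact ⟨⟨(hterr x μ h1 h2).1, (hterr x μ h1 h2).2.1⟩, (hterr (x - e μ) μ h3 h4).1, (hterr (x - e μ) μ h3 h4).2.1⟩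

end Summit.QuantumFields.YangMills.Theorems.HalvingP1FlatCoreSupplierPreGaugeMember

end
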